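import Summits.HubbardSuperconductivity.HubbardSuperconductivity.Theorems.WidthHaldaneTubeSemiconcave

/-!
# The Landau (yrast) form of the flux envelope of the Hubbard tube

Support file for crux `WidthUniformThermodynamics` (stmt-HubbardSuperconductivity-16312; routes
`WidthHaldane`, `SeamInduction`; objects of `Theorems/WidthHaldaneDefs.lean`). Conjunct (i) of the
crux is a FLOOR on the flux envelope `E(θ) = tubeEnergy` at `θ₀ = π/3`. The crux idea
`Cruxes/WidthUniformThermodynamics/Ideas/landau-window-yrast.md` and the typing note of
`Cruxes/WidthUniformThermodynamics/FLOOR-INVENTORY-k2r1.md` (§"the Landau form": `LandauIdentity`,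
`LandauFloor`) both start from one elementary reformulation, PROVED here in the route's vocabulary,
without definitions and without named facts. In the uniform twist gauge (landed:
`expect_gauged_tubeH`, `re_expect_gauged_tubeH`) the flux enters only through the phase `θ/L` on the
longitudinal bonds, and for every unit vector `ψ` of the sector `(N, S^z = 0)`

  `Re⟨W_θᴴψ, (H₀ + Tw_θ) W_θᴴψ⟩ = Re⟨ψ, H₀ψ⟩ + (1 - cos(θ/L))·K(ψ) + sin(θ/L)·J(ψ)`

with the LONGITUDINAL KINETIC FORM `K(ψ) = Σ_{x,σ} 2Re⟨ψ, c†_{x+e₁,σ}c_{xσ}ψ⟩` and the TOTAL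
LONGITUDINAL CURRENT `J(ψ) = Σ_{x,σ} 2Im⟨ψ, c†_{x+e₁,σ}c_{xσ}ψ⟩` of the UNTWISTED tube
(both written out — a line naming the operators `K_x = Σ(c†_{(a,b)σ}c_{(a-1,b)σ} + h.c.)`,
`J_x = -i Σ(c†_{(a,b)σ}c_{(a-1,b)σ} - h.c.)` recovers them by `expect_sum`):

* `tubeEnergy_le_re_expect_add_price`, `tubeEnergy_eq_sInf_price`, `le_tubeEnergy_of_forall_price_ge`
  — Rayleigh bound / variational identity / floor transfer with the raw gauged price;
* `price_eq_landau_site`, `siteForms_eq_columnForms`, **`price_eq_landau`** — the price IS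
  `(1 - cos(θ/L))K(ψ) + sin(θ/L)J(ψ)` (`L ≥ 3`), with `K`, `J` in the tree's COLUMN coordinates
  `K(ψ) = Σ_{a,b,σ} Re⟨ψ,(c†_{(a,b)σ}c_{(a-1,b)σ} + h.c.)ψ⟩` (as in `WidthHaldaneKineticFloor`),
  `J(ψ) = Σ_{a,b,σ} Im⟨ψ,(c†_{(a,b)σ}c_{(a-1,b)σ} - h.c.)ψ⟩`;
* **`tubeEnergy_le_landau`** / `landauGaugeBound` (closed form, the registered sub-goal) —
  `E(θ, N) ≤ Re⟨ψ,H₀ψ⟩ + (1 - cos(θ/L))K(ψ) + sin(θ/L)J(ψ)`; averaging `±θ` kills `J` and gives back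
  the sharp Bloch bound of `WidthHaldaneBridgeSharpBloch`, keeping `J` is what a FLOOR needs.

Companions: `WidthHaldaneTubeLandauWindow.lean` (`|K|, |J| ≤ 2LM`, Landau identity, floor transfer,
reverse Bloch bound), `WidthHaldaneTubeLandauCriterion.lean` (stiffness from a Landau criterion). Handles for a line typed in Landau form, not progress on
the open core. References: F. Bloch, Phys. Rev. A 7 (1973) 2187; D. Bohm, Phys. Rev. 75 (1949) 502;
H. Watanabe, J. Stat. Phys. 177 (2019) 717, §2.2–§4.1.
-/

noncomputable section

namespace Summit.HubbardSuperconductivity.HubbardSuperconductivity.Theorems.WidthHaldane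

set_option linter.dupNamespace false -- summit = problem name (single-conjunct summit), D-0017

open scoped BigOperators Classical Matrix ComplexConjugate
open Matrix Literature.MathematicalPhysics.QuantumLattice

section LandauForm

variable (L M : ℕ) [NeZero L] [NeZero M] (Λ : Type) [LinearOrder Λ] [Fintype Λ]
  (e : Λ ≃ ZMod L × ZMod M)

/-! ### The gauge Rayleigh bound and the variational identity, price form -/

/-- **The gauge Rayleigh bound, price form** (`L ≥ 3`): for every unit vector `ψ` of the sector
`(N, S^z = 0)`, `E_{L,M}(U; θ, N) ≤ Re⟨ψ, H₀ψ⟩ + Σ_{x∼y,σ} Re[(1 - ω_θ(x,y))⟨ψ, c†_{xσ}c_{yσ}ψ⟩]`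
with the uniform Peierls weights `ω_θ = e^{± iθ/L}` on the longitudinal bonds, `1` transversally
(price `W_θᴴψ` in the twisted tube). [cite: Watanabe2019, §2.2.3 and §4.1] -/
theorem tubeEnergy_le_re_expect_add_price (hL : 3 ≤ L) (U θ : ℝ) (N : ℕ) {ψ : Fock (Orb Λ)}
    (hψ : ψ ∈ szSector N 0) (h1 : star ψ ⬝ᵥ ψ = 1) :
    tubeEnergy L M Λ e U θ N ≤ (expect (tubeH0 L M Λ e U) ψ).re +
      ∑ x : Λ, ∑ y : Λ, ∑ σ : Fin 2, if (tubeGraph e).Adj x y then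
        ((1 - (if (e x).1 = (e y).1 + 1 ∧ (e x).2 = (e y).2 then Complex.exp (((θ / L : ℝ) : ℂ) * Complex.I)
          else if (e y).1 = (e x).1 + 1 ∧ (e x).2 = (e y).2 then Complex.exp (-(((θ / L : ℝ) : ℂ) * Complex.I))
          else 1)) * expect (creation (orb x σ) * annihilation (orb y σ)) ψ).re
        else 0 := by
  rw [← re_expect_gauged_tubeH L M Λ e hL U θ ψ]
  set g : Λ → Circle := fun z : Λ => Circle.exp (θ / L * ((e z).1.val : ℝ)) with hg
  have hunit := minEnergyOn_szSector_phaseGauge_conj g⁻¹ (tubeH0 L M Λ e U + tubeTwist L M Λ e θ) N 0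
  rw [phaseGauge_conjTranspose, inv_inv, ← phaseGauge_conjTranspose g] at hunit
  rw [tubeEnergy_eq, ← hunit]
  exact minEnergyOn_le_rayleigh_of_mem
    (Matrix.isHermitian_mul_mul_conjTranspose _ (isHermitian_tubeH L M Λ e U θ)) _ hψ h1

/-- **The variational identity, price form** (`L ≥ 3`): `E_{L,M}(U; θ, N)` is the infimum over the
unit vectors `ψ` of the sector `(N, S^z = 0)` of `Re⟨ψ, H₀ψ⟩ + Σ_{x∼y,σ} Re[(1 - ω_θ(x,y))⟨ψ, c†_{xσ}c_{yσ}ψ⟩]`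
(unitary invariance of the sector energy under the twist gauge). [cite: Watanabe2019, §2.2.3 and §4.1] -/
theorem tubeEnergy_eq_sInf_price (hL : 3 ≤ L) (U θ : ℝ) (N : ℕ) :
    tubeEnergy L M Λ e U θ N = sInf {F : ℝ | ∃ ψ ∈ szSector (Λ := Λ) N 0, star ψ ⬝ᵥ ψ = 1 ∧
      F = (expect (tubeH0 L M Λ e U) ψ).re +
        ∑ x : Λ, ∑ y : Λ, ∑ σ : Fin 2, if (tubeGraph e).Adj x y then
          ((1 - (if (e x).1 = (e y).1 + 1 ∧ (e x).2 = (e y).2 then Complex.exp (((θ / L : ℝ) : ℂ) * Complex.I)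
            else if (e y).1 = (e x).1 + 1 ∧ (e x).2 = (e y).2 then Complex.exp (-(((θ / L : ℝ) : ℂ) * Complex.I))
            else 1)) * expect (creation (orb x σ) * annihilation (orb y σ)) ψ).re
          else 0} := by
  set g : Λ → Circle := fun z : Λ => Circle.exp (θ / L * ((e z).1.val : ℝ)) with hg
  have hunit := minEnergyOn_szSector_phaseGauge_conj g⁻¹ (tubeH0 L M Λ e U + tubeTwist L M Λ e θ) N 0
  rw [phaseGauge_conjTranspose, inv_inv, ← phaseGauge_conjTranspose g] at hunit
  rw [tubeEnergy_eq, ← hunit, Matrix.minEnergyOn]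
  congr 1
  ext F
  simp only [Set.mem_setOf_eq]
  refine exists_congr fun ψ => and_congr_right fun _ => and_congr_right fun _ => ?_
  rw [← re_expect_gauged_tubeH L M Λ e hL U θ ψ]
  rfl

/-- **Floor transfer, price form** (`L ≥ 3`): if the sector `(N, S^z = 0)` has a unit vector and
`c ≤ Re⟨ψ, H₀ψ⟩ + Σ_{x∼y,σ} Re[(1 - ω_θ(x,y))⟨ψ, c†_{xσ}c_{yσ}ψ⟩]` for every unit vector of the sector,
then `c ≤ E_{L,M}(U; θ, N)`. [folklore] -/
theorem le_tubeEnergy_of_forall_price_ge (hL : 3 ≤ L) (U θ : ℝ) (N : ℕ) {c : ℝ}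
    (hne : ∃ ψ ∈ szSector (Λ := Λ) N 0, star ψ ⬝ᵥ ψ = 1)
    (h : ∀ ψ ∈ szSector (Λ := Λ) N 0, star ψ ⬝ᵥ ψ = 1 →
      c ≤ (expect (tubeH0 L M Λ e U) ψ).re +
        ∑ x : Λ, ∑ y : Λ, ∑ σ : Fin 2, if (tubeGraph e).Adj x y then
          ((1 - (if (e x).1 = (e y).1 + 1 ∧ (e x).2 = (e y).2 then Complex.exp (((θ / L : ℝ) : ℂ) * Complex.I)
            else if (e y).1 = (e x).1 + 1 ∧ (e x).2 = (e y).2 then Complex.exp (-(((θ / L : ℝ) : ℂ) * Complex.I))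
            else 1)) * expect (creation (orb x σ) * annihilation (orb y σ)) ψ).re
          else 0) :
    c ≤ tubeEnergy L M Λ e U θ N := by
  rw [tubeEnergy_eq_sInf_price L M Λ e hL U θ N]
  obtain ⟨ψ₀, hψ₀, h₀⟩ := hne
  refine le_csInf ⟨_, ψ₀, hψ₀, h₀, rfl⟩ ?_
  rintro F ⟨ψ, hψ, h1, rfl⟩
  exact h ψ hψ h1

/-! ### Splitting the price into the kinetic form and the current -/

omit [NeZero L] [NeZero M] [LinearOrder Λ] [Fintype Λ] in
/-- The real part of one gauged hopping term: `Re[(1 - e^{iφ})h] = (1 - cos φ)Re h + sin φ Im h` on a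
bond oriented against `e₁`, `Re[(1 - e^{-iφ})h] = (1 - cos φ)Re h - sin φ Im h` along `e₁`, and `0` on
the transverse bonds (`φ = θ/L`). [folklore] -/
theorem re_one_sub_peierlsWeight_mul (θ : ℝ) (x y : Λ) (h : ℂ) :
    ((1 - (if (e x).1 = (e y).1 + 1 ∧ (e x).2 = (e y).2 then Complex.exp (((θ / L : ℝ) : ℂ) * Complex.I)
        else if (e y).1 = (e x).1 + 1 ∧ (e x).2 = (e y).2 then Complex.exp (-(((θ / L : ℝ) : ℂ) * Complex.I))
        else 1)) * h).re =
      if (e x).1 = (e y).1 + 1 ∧ (e x).2 = (e y).2 then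
        (1 - Real.cos (θ / L)) * h.re + Real.sin (θ / L) * h.im
      else if (e y).1 = (e x).1 + 1 ∧ (e x).2 = (e y).2 then
        (1 - Real.cos (θ / L)) * h.re - Real.sin (θ / L) * h.im
      else 0 := by
  split_ifs with hA hB
  · rw [Complex.mul_re, Complex.sub_re, Complex.sub_im, Complex.one_re, Complex.one_im,
      Complex.exp_ofReal_mul_I_re, Complex.exp_ofReal_mul_I_im]
    ring
  · rw [← neg_mul, ← Complex.ofReal_neg, Complex.mul_re, Complex.sub_re, Complex.sub_im, Complex.one_re,
      Complex.one_im, Complex.exp_ofReal_mul_I_re, Complex.exp_ofReal_mul_I_im, Real.cos_neg,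
      Real.sin_neg]
    ring
  · rw [sub_self, zero_mul, Complex.zero_re]

omit [NeZero L] [NeZero M] [LinearOrder Λ] [Fintype Λ] in
/-- A pair oriented against `e₁` (`x = y + e₁`) is an edge of the tube (`L ≥ 3`). [folklore] -/
theorem adj_of_step_fst (hL : 3 ≤ L) {x y : Λ} (h : (e x).1 = (e y).1 + 1 ∧ (e x).2 = (e y).2) :
    (tubeGraph e).Adj x y := by
  haveI : Fact (1 < L) := ⟨by omega⟩
  have hx : x = e.symm ((e y).1 + 1, (e y).2) := by
    apply e.injective
    rw [Equiv.apply_symm_apply]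
    exact Prod.ext h.1 h.2
  simp only [tubeGraph, SimpleGraph.fromRel_adj, ne_eq]
  refine ⟨fun hxy => ?_, Or.inr (Or.inl hx)⟩
  subst hxy
  exact one_ne_zero (by linear_combination h.1.symm : (1 : ZMod L) = 0)

omit [NeZero L] [NeZero M] [LinearOrder Λ] [Fintype Λ] in
/-- A pair oriented along `e₁` (`y = x + e₁`) is an edge of the tube (`L ≥ 3`). [folklore] -/
theorem adj_of_step_snd (hL : 3 ≤ L) {x y : Λ} (h : (e y).1 = (e x).1 + 1 ∧ (e x).2 = (e y).2) :
    (tubeGraph e).Adj x y := by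
  haveI : Fact (1 < L) := ⟨by omega⟩
  have hy : y = e.symm ((e x).1 + 1, (e x).2) := by
    apply e.injective
    rw [Equiv.apply_symm_apply]
    exact Prod.ext h.1 h.2.symm
  simp only [tubeGraph, SimpleGraph.fromRel_adj, ne_eq]
  refine ⟨fun hxy => ?_, Or.inl (Or.inl hy)⟩
  subst hxy
  exact one_ne_zero (by linear_combination h.1.symm : (1 : ZMod L) = 0)

omit [NeZero L] [NeZero M] [LinearOrder Λ] in
/-- Re-indexing the bonds oriented against `e₁`: `Σ_{x,y} [x = y + e₁] F(x,y) = Σ_y F(y + e₁, y)`. [folklore] -/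
theorem sum_sum_ite_step_fst {β : Type*} [AddCommMonoid β] (F : Λ → Λ → β) :
    (∑ x : Λ, ∑ y : Λ, if (e x).1 = (e y).1 + 1 ∧ (e x).2 = (e y).2 then F x y else 0) =
      ∑ y : Λ, F (e.symm ((e y).1 + 1, (e y).2)) y := by
  rw [Finset.sum_comm]
  refine Finset.sum_congr rfl fun y _ => ?_
  have hiff : ∀ x : Λ, ((e x).1 = (e y).1 + 1 ∧ (e x).2 = (e y).2) ↔ x = e.symm ((e y).1 + 1, (e y).2) := by
    intro x
    constructor
    · rintro ⟨h1, h2⟩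
      apply e.injective
      rw [Equiv.apply_symm_apply]
      exact Prod.ext h1 h2
    · rintro rfl
      simp
  simp only [hiff, Finset.sum_ite_eq', Finset.mem_univ, if_true]

omit [NeZero L] [NeZero M] [LinearOrder Λ] in
/-- Re-indexing the bonds oriented along `e₁`: `Σ_{x,y} [y = x + e₁] F(x,y) = Σ_x F(x, x + e₁)`. [folklore] -/
theorem sum_sum_ite_step_snd {β : Type*} [AddCommMonoid β] (F : Λ → Λ → β) :
    (∑ x : Λ, ∑ y : Λ, if (e y).1 = (e x).1 + 1 ∧ (e x).2 = (e y).2 then F x y else 0) =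
      ∑ x : Λ, F x (e.symm ((e x).1 + 1, (e x).2)) := by
  refine Finset.sum_congr rfl fun x _ => ?_
  have hiff : ∀ y : Λ, ((e y).1 = (e x).1 + 1 ∧ (e x).2 = (e y).2) ↔ y = e.symm ((e x).1 + 1, (e x).2) := by
    intro y
    constructor
    · rintro ⟨h1, h2⟩
      apply e.injective
      rw [Equiv.apply_symm_apply]
      exact Prod.ext h1 h2.symm
    · rintro rfl
      simp
  simp only [hiff, Finset.sum_ite_eq', Finset.mem_univ, if_true]

omit [NeZero L] [NeZero M] in
/-- The reversed hop has the conjugate expectation (`(c†_p c_q)ᴴ = c†_q c_p`). [folklore] -/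
theorem expect_hop_swap_re_im (x y : Λ) (σ : Fin 2) (ψ : Fock (Orb Λ)) :
    (expect (creation (orb x σ) * annihilation (orb y σ)) ψ).re =
        (expect (creation (orb y σ) * annihilation (orb x σ)) ψ).re ∧
      (expect (creation (orb x σ) * annihilation (orb y σ)) ψ).im =
        -(expect (creation (orb y σ) * annihilation (orb x σ)) ψ).im := by
  have h : expect (creation (orb x σ) * annihilation (orb y σ)) ψ =
      (starRingEnd ℂ) (expect (creation (orb y σ) * annihilation (orb x σ)) ψ) := by
    have hct : (creation (orb y σ) * annihilation (orb x σ) : Matrix (Finset (Orb Λ)) (Finset (Orb Λ)) ℂ)ᴴ =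
        creation (orb x σ) * annihilation (orb y σ) := by
      rw [conjTranspose_mul, creation_conjTranspose, annihilation_conjTranspose]
    rw [← hct, expect, expect, Matrix.star_dotProduct_conjTranspose_mulVec_eq_star, Complex.star_def]
  rw [h, Complex.conj_re, Complex.conj_im]
  exact ⟨rfl, rfl⟩

omit [NeZero L] [NeZero M] in
/-- **The price is the Landau form, site-indexed** (`L ≥ 3`):
`Σ_{x∼y,σ} Re[(1 - ω_θ(x,y))⟨ψ, c†_{xσ}c_{yσ}ψ⟩] = (1 - cos(θ/L))·Σ_{x,σ} 2Re⟨ψ, c†_{x+e₁,σ}c_{xσ}ψ⟩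
+ sin(θ/L)·Σ_{x,σ} 2Im⟨ψ, c†_{x+e₁,σ}c_{xσ}ψ⟩`. [cite: Watanabe2019, §2.2.3 and §4.1] -/
theorem price_eq_landau_site (hL : 3 ≤ L) (θ : ℝ) (ψ : Fock (Orb Λ)) :
    (∑ x : Λ, ∑ y : Λ, ∑ σ : Fin 2, if (tubeGraph e).Adj x y then
        ((1 - (if (e x).1 = (e y).1 + 1 ∧ (e x).2 = (e y).2 then Complex.exp (((θ / L : ℝ) : ℂ) * Complex.I)
          else if (e y).1 = (e x).1 + 1 ∧ (e x).2 = (e y).2 then Complex.exp (-(((θ / L : ℝ) : ℂ) * Complex.I))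
          else 1)) * expect (creation (orb x σ) * annihilation (orb y σ)) ψ).re
        else 0) =
      (1 - Real.cos (θ / L)) * (∑ x : Λ, ∑ σ : Fin 2,
          2 * (expect (creation (orb (e.symm ((e x).1 + 1, (e x).2)) σ) * annihilation (orb x σ)) ψ).re) +
        Real.sin (θ / L) * (∑ x : Λ, ∑ σ : Fin 2,
          2 * (expect (creation (orb (e.symm ((e x).1 + 1, (e x).2)) σ) * annihilation (orb x σ)) ψ).im) := by
  -- pointwise: the guarded summand is the sum of its two oriented parts
  have hpt : ∀ (x y : Λ) (σ : Fin 2),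
      (if (tubeGraph e).Adj x y then
        ((1 - (if (e x).1 = (e y).1 + 1 ∧ (e x).2 = (e y).2 then Complex.exp (((θ / L : ℝ) : ℂ) * Complex.I)
          else if (e y).1 = (e x).1 + 1 ∧ (e x).2 = (e y).2 then Complex.exp (-(((θ / L : ℝ) : ℂ) * Complex.I))
          else 1)) * expect (creation (orb x σ) * annihilation (orb y σ)) ψ).re
        else 0) =
      (if (e x).1 = (e y).1 + 1 ∧ (e x).2 = (e y).2 then
          (1 - Real.cos (θ / L)) * (expect (creation (orb x σ) * annihilation (orb y σ)) ψ).re +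
            Real.sin (θ / L) * (expect (creation (orb x σ) * annihilation (orb y σ)) ψ).im else 0) +
        (if (e y).1 = (e x).1 + 1 ∧ (e x).2 = (e y).2 then
          (1 - Real.cos (θ / L)) * (expect (creation (orb x σ) * annihilation (orb y σ)) ψ).re -
            Real.sin (θ / L) * (expect (creation (orb x σ) * annihilation (orb y σ)) ψ).im else 0) := by
    intro x y σ
    rw [re_one_sub_peierlsWeight_mul]
    by_cases hA : (e x).1 = (e y).1 + 1 ∧ (e x).2 = (e y).2
    · have hB : ¬((e y).1 = (e x).1 + 1 ∧ (e x).2 = (e y).2) := fun hB => not_both_steps L hL hA.1 hB.1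
      simp only [if_pos (adj_of_step_fst L M Λ e hL hA), if_pos hA, if_neg hB, add_zero]
    · by_cases hB : (e y).1 = (e x).1 + 1 ∧ (e x).2 = (e y).2
      · simp only [if_pos (adj_of_step_snd L M Λ e hL hB), if_neg hA, if_pos hB, zero_add]
      · simp only [if_neg hA, if_neg hB, ite_self, add_zero]
  have hite : ∀ (c : Prop) [Decidable c] (f : Fin 2 → ℝ),
      (∑ σ : Fin 2, if c then f σ else 0) = if c then ∑ σ : Fin 2, f σ else 0 := by
    intro c _ f
    split_ifs <;> simp
  simp only [hpt]
  simp only [Finset.sum_add_distrib]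
  simp only [hite]
  rw [sum_sum_ite_step_fst L M Λ e (fun x y => ∑ σ : Fin 2,
      ((1 - Real.cos (θ / L)) * (expect (creation (orb x σ) * annihilation (orb y σ)) ψ).re +
        Real.sin (θ / L) * (expect (creation (orb x σ) * annihilation (orb y σ)) ψ).im)),
    sum_sum_ite_step_snd L M Λ e (fun x y => ∑ σ : Fin 2,
      ((1 - Real.cos (θ / L)) * (expect (creation (orb x σ) * annihilation (orb y σ)) ψ).re -
        Real.sin (θ / L) * (expect (creation (orb x σ) * annihilation (orb y σ)) ψ).im))]
  rw [Finset.mul_sum, Finset.mul_sum, ← Finset.sum_add_distrib, ← Finset.sum_add_distrib]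
  refine Finset.sum_congr rfl fun x _ => ?_
  rw [Finset.mul_sum, Finset.mul_sum, ← Finset.sum_add_distrib, ← Finset.sum_add_distrib]
  refine Finset.sum_congr rfl fun σ _ => ?_
  obtain ⟨hre, him⟩ := expect_hop_swap_re_im Λ x (e.symm ((e x).1 + 1, (e x).2)) σ ψ
  rw [hre, him]
  ring

/-! ### Column coordinates: the kinetic form `K` and the current `J` of the tree -/

/-- **Column coordinates.** The site-indexed forms are the tree's column forms:
`Σ_{x,σ} 2Re⟨ψ, c†_{x+e₁,σ}c_{xσ}ψ⟩ = K(ψ) := Σ_{a,b,σ} Re⟨ψ, (c†_{(a,b)σ}c_{(a-1,b)σ} + c†_{(a-1,b)σ}c_{(a,b)σ})ψ⟩`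
(the longitudinal kinetic form of `WidthHaldaneKineticFloor`) and
`Σ_{x,σ} 2Im⟨ψ, c†_{x+e₁,σ}c_{xσ}ψ⟩ = J(ψ) := Σ_{a,b,σ} Im⟨ψ, (c†_{(a,b)σ}c_{(a-1,b)σ} - c†_{(a-1,b)σ}c_{(a,b)σ})ψ⟩`
(the total longitudinal particle current, `Σ_{bonds,σ} ⟨i(c†_{(a-1,b)σ}c_{(a,b)σ} - h.c.)⟩`). [folklore] -/
theorem siteForms_eq_columnForms (ψ : Fock (Orb Λ)) :
    (∑ x : Λ, ∑ σ : Fin 2,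
        2 * (expect (creation (orb (e.symm ((e x).1 + 1, (e x).2)) σ) * annihilation (orb x σ)) ψ).re) =
      ∑ a : ZMod L, ∑ b : ZMod M, ∑ σ : Fin 2,
        (expect (creation (orb (e.symm (a, b)) σ) * annihilation (orb (e.symm (a - 1, b)) σ) +
          creation (orb (e.symm (a - 1, b)) σ) * annihilation (orb (e.symm (a, b)) σ)) ψ).re ∧
    (∑ x : Λ, ∑ σ : Fin 2,
        2 * (expect (creation (orb (e.symm ((e x).1 + 1, (e x).2)) σ) * annihilation (orb x σ)) ψ).im) =
      ∑ a : ZMod L, ∑ b : ZMod M, ∑ σ : Fin 2,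
        (expect (creation (orb (e.symm (a, b)) σ) * annihilation (orb (e.symm (a - 1, b)) σ) -
          creation (orb (e.symm (a - 1, b)) σ) * annihilation (orb (e.symm (a, b)) σ)) ψ).im := by
  -- coordinates `x = e.symm (a', b)`, then the shift `a' = a - 1`
  have hcoord : ∀ F : Λ → ℝ, ∑ x : Λ, F x = ∑ a : ZMod L, ∑ b : ZMod M, F (e.symm (a, b)) := by
    intro F
    rw [← Fintype.sum_prod_type', ← Equiv.sum_comp e.symm]
  have hshift : ∀ G : ZMod L → ℝ, ∑ a : ZMod L, G a = ∑ a : ZMod L, G (a - 1) := fun G =>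
    Fintype.sum_equiv (Equiv.addRight (1 : ZMod L)) _ _ fun a => by
      simp only [Equiv.coe_addRight, add_sub_cancel_right]
  have hsub : ∀ X Y : Matrix (Finset (Orb Λ)) (Finset (Orb Λ)) ℂ, expect (X - Y) ψ = expect X ψ - expect Y ψ := by
    intro X Y
    simp [expect, sub_mulVec, dotProduct_sub]
  constructor
  · rw [hcoord, hshift]
    simp only [Equiv.apply_symm_apply, sub_add_cancel]
    refine Finset.sum_congr rfl fun a _ => Finset.sum_congr rfl fun b _ => Finset.sum_congr rfl fun σ _ => ?_
    rw [expect_add, Complex.add_re, (expect_hop_swap_re_im Λ (e.symm (a - 1, b)) (e.symm (a, b)) σ ψ).1]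
    ring
  · rw [hcoord, hshift]
    simp only [Equiv.apply_symm_apply, sub_add_cancel]
    refine Finset.sum_congr rfl fun a _ => Finset.sum_congr rfl fun b _ => Finset.sum_congr rfl fun σ _ => ?_
    rw [hsub, Complex.sub_im, (expect_hop_swap_re_im Λ (e.symm (a - 1, b)) (e.symm (a, b)) σ ψ).2]
    ring

/-- **The price is the Landau form** (`L ≥ 3`): `Σ_{x∼y,σ} Re[(1 - ω_θ(x,y))⟨ψ, c†_{xσ}c_{yσ}ψ⟩]
= (1 - cos(θ/L))·K(ψ) + sin(θ/L)·J(ψ)` with the longitudinal kinetic form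
`K(ψ) = Σ_{a,b,σ} Re⟨ψ, (c†_{(a,b)σ}c_{(a-1,b)σ} + h.c.)ψ⟩` and the total longitudinal current
`J(ψ) = Σ_{a,b,σ} Im⟨ψ, (c†_{(a,b)σ}c_{(a-1,b)σ} - h.c.)ψ⟩` of the untwisted tube (column
coordinates, as in `WidthHaldaneKineticFloor`). [cite: Watanabe2019, §2.2.3 and §4.1] -/
theorem price_eq_landau (hL : 3 ≤ L) (θ : ℝ) (ψ : Fock (Orb Λ)) :
    (∑ x : Λ, ∑ y : Λ, ∑ σ : Fin 2, if (tubeGraph e).Adj x y then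
        ((1 - (if (e x).1 = (e y).1 + 1 ∧ (e x).2 = (e y).2 then Complex.exp (((θ / L : ℝ) : ℂ) * Complex.I)
          else if (e y).1 = (e x).1 + 1 ∧ (e x).2 = (e y).2 then Complex.exp (-(((θ / L : ℝ) : ℂ) * Complex.I))
          else 1)) * expect (creation (orb x σ) * annihilation (orb y σ)) ψ).re
        else 0) =
      (1 - Real.cos (θ / L)) * (∑ a : ZMod L, ∑ b : ZMod M, ∑ σ : Fin 2,
          (expect (creation (orb (e.symm (a, b)) σ) * annihilation (orb (e.symm (a - 1, b)) σ) +
            creation (orb (e.symm (a - 1, b)) σ) * annihilation (orb (e.symm (a, b)) σ)) ψ).re) +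
        Real.sin (θ / L) * (∑ a : ZMod L, ∑ b : ZMod M, ∑ σ : Fin 2,
          (expect (creation (orb (e.symm (a, b)) σ) * annihilation (orb (e.symm (a - 1, b)) σ) -
            creation (orb (e.symm (a - 1, b)) σ) * annihilation (orb (e.symm (a, b)) σ)) ψ).im) := by
  obtain ⟨hK, hJ⟩ := siteForms_eq_columnForms L M Λ e ψ
  rw [← hK, ← hJ]
  exact price_eq_landau_site L M Λ e hL θ ψ

/-! ### The gauge Rayleigh bound in Landau form -/

/-- **The gauge Rayleigh bound in Landau form** (`L ≥ 3`): for every unit vector `ψ` of the sector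
`(N, S^z = 0)`, `E_{L,M}(U; θ, N) ≤ Re⟨ψ, H₀ψ⟩ + (1 - cos(θ/L))·K(ψ) + sin(θ/L)·J(ψ)` (price the
boosted state `W_θᴴψ` in the twisted tube; Bohm 1949, F. Bloch 1973; averaging `±θ` kills `J` and
returns the sharp Bloch bound `stub_sharpBloch`). [cite: Watanabe2019, §2.2.3 and §4.1] -/
theorem tubeEnergy_le_landau (hL : 3 ≤ L) (U θ : ℝ) (N : ℕ) {ψ : Fock (Orb Λ)}
    (hψ : ψ ∈ szSector N 0) (h1 : star ψ ⬝ᵥ ψ = 1) :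
    tubeEnergy L M Λ e U θ N ≤ (expect (tubeH0 L M Λ e U) ψ).re +
      (1 - Real.cos (θ / L)) * (∑ a : ZMod L, ∑ b : ZMod M, ∑ σ : Fin 2,
          (expect (creation (orb (e.symm (a, b)) σ) * annihilation (orb (e.symm (a - 1, b)) σ) +
            creation (orb (e.symm (a - 1, b)) σ) * annihilation (orb (e.symm (a, b)) σ)) ψ).re) +
        Real.sin (θ / L) * (∑ a : ZMod L, ∑ b : ZMod M, ∑ σ : Fin 2,
          (expect (creation (orb (e.symm (a, b)) σ) * annihilation (orb (e.symm (a - 1, b)) σ) -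
            creation (orb (e.symm (a - 1, b)) σ) * annihilation (orb (e.symm (a, b)) σ)) ψ).im) := by
  have h := tubeEnergy_le_re_expect_add_price L M Λ e hL U θ N hψ h1
  rw [price_eq_landau L M Λ e hL θ ψ] at h
  linarith

end LandauForm

/-- **THE GAUGE RAYLEIGH BOUND IN LANDAU FORM, closed form** (the registered sub-goal
`landauGaugeBound` of crux stmt-HubbardSuperconductivity-16312; all binders universally
quantified): for `L ≥ 3`, every `U, θ, N`, every labelling and every unit vector `ψ` of the sector
`(N, S^z = 0)`, `E_{L,M}(U; θ, N) ≤ Re⟨ψ, H₀ψ⟩ + (1 - cos(θ/L))·K(ψ) + sin(θ/L)·J(ψ)`.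
[cite: Watanabe2019, §2.2.3 and §4.1] -/
theorem landauGaugeBound : ∀ (L M : ℕ) [NeZero L] [NeZero M] (Λ : Type) [LinearOrder Λ] [Fintype Λ] (e : Λ ≃ ZMod L × ZMod M), 3 ≤ L → ∀ (U θ : ℝ) (N : ℕ) (ψ : Fock (Orb Λ)), ψ ∈ szSector N 0 → star ψ ⬝ᵥ ψ = 1 → tubeEnergy L M Λ e U θ N ≤ (expect (tubeH0 L M Λ e U) ψ).re + (1 - Real.cos (θ / L)) * (∑ a : ZMod L, ∑ b : ZMod M, ∑ σ : Fin 2, (expect (creation (orb (e.symm (a, b)) σ) * annihilation (orb (e.symm (a - 1, b)) σ) + creation (orb (e.symm (a - 1, b)) σ) * annihilation (orb (e.symm (a, b)) σ)) ψ).re) + Real.sin (θ / L) * (∑ a : ZMod L, ∑ b : ZMod M, ∑ σ : Fin 2, (expect (creation (orb (e.symm (a, b)) σ) * annihilation (orb (e.symm (a - 1, b)) σ) - creation (orb (e.symm (a - 1, b)) σ) * annihilation (orb (e.symm (a, b)) σ)) ψ).im) :=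
  fun L M _ _ Λ _ _ e hL U θ N _ψ hψ h1 => tubeEnergy_le_landau L M Λ e hL U θ N hψ h1

end Summit.HubbardSuperconductivity.HubbardSuperconductivity.Theorems.WidthHaldane

end
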